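import Literature.MathematicalPhysics.KineticTheory.HardSphereEulerProofs
import Summits.AtomisticToContinuum.HydrodynamicLimit.Theorems.PolynomialCompression.Negative.EntropyHardSphere
import Literature.Analysis.FunctionSpaces.TorusSpaceTime
import Mathlib.MeasureTheory.Measure.HasOuterApproxClosed
import Mathlib.MeasureTheory.Function.AEEqOfLIntegral

/-!
# The squeeze `SqueezeToBlockGibbs` (route JaynesSqueeze), V: limits in probability, entropy conservation, preliminaries

Helper file (`--supports stmt-AtomisticToContinuum-13463`) for the support item `SqueezeToBlockGibbs` of route
`JaynesSqueeze`. Step (iii) of the item's plan identifies the fine-grained entropy of the initial local Gibbs law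
with the thermodynamic entropy `𝒮[U₀]` of the Euler data. Two elementary facts about limits in probability on
a SEQUENCE of probability spaces (the `(N+1)`-particle phase spaces) are used:

* `tendsto_integral_of_tendsto_measure_gt` — a uniformly bounded sequence of observables converging in
  probability to a constant converges in mean (so the LLN density of the static input `HardSphereLDA` (B), a
  limit of MEANS, is the in-probability LLN density);
* `ae_eq_of_forall_integral_mul_eq` — two nonnegative integrable functions on `𝕋³` with equal integrals against
  every continuous test function agree almost everywhere (finite Borel measures on a metric space are determined
  by bounded continuous functions).

The data pinning itself (two field triples tied at `t = 0` to the same local Gibbs laws coincide) is the tree's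
`TwoClocksClampedWindowDockTimeZero.data_eq_of_ties`, used by the assembly file. Also here, small preliminaries of
the assembly: measurability of `g ∘ f` for `g` continuous on the range of `f`, a cube-root bookkeeping lemma, a
positive lower bound for smooth positive fields on `[0, t] × 𝕋³`, the boundedness of the empirical density field,
and ENTROPY CONSERVATION along dilute classical hard-sphere Euler solutions (`integral_density_mul_hsEnt_eq`, the
specialisation of `PolynomialCompressionEntropy.integral_density_mul_comp_ent_eq` under the `HsEosLowDensity` data).

References: Olla–Varadhan–Yau 1993 §1; Spohn 1991 Part I §2.3.
-/

noncomputable section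

open MeasureTheory Filter Set Topology
open scoped ENNReal BoundedContinuousFunction

namespace Summit.AtomisticToContinuum.HydrodynamicLimit.Theorems.JaynesSqueezeSqueeze

open Literature.MathematicalPhysics.KineticTheory Literature.Analysis.FluidPDE
open Literature.Analysis.FunctionSpaces

/-! ## Bounded convergence in probability gives convergence of means -/

/-- **Bounded convergence in probability implies convergence in mean** (varying probability spaces): if
`|X_N| ≤ M`, `|c| ≤ M` and `P_N(δ < |X_N − c|) → 0` for every `δ > 0`, then `E_{P_N} X_N → c`. [folklore] -/
theorem tendsto_integral_of_tendsto_measure_gt {Ω : ℕ → Type*} [∀ N, MeasurableSpace (Ω N)]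
    {P : (N : ℕ) → Measure (Ω N)} (hP : ∀ᶠ N in atTop, IsProbabilityMeasure (P N))
    {X : (N : ℕ) → Ω N → ℝ} (hXm : ∀ N, Measurable (X N)) {M c : ℝ} (hM : ∀ N ω, |X N ω| ≤ M) (hc : |c| ≤ M)
    (h : ∀ δ > (0 : ℝ), Tendsto (fun N => P N {ω | δ < |X N ω - c|}) atTop (𝓝 0)) :
    Tendsto (fun N => ∫ ω, X N ω ∂P N) atTop (𝓝 c) := by
  have hM0 : 0 ≤ M := (abs_nonneg c).trans hc
  rw [Metric.tendsto_atTop]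
  intro ε hε
  set δ : ℝ := ε / 3 with hδ
  have hδ0 : 0 < δ := by positivity
  -- eventually the bad event has probability at most `ε / (3 (2M + 1))`
  have hη : 0 < ε / (3 * (2 * M + 1)) := by positivity
  have hev : ∀ᶠ N in atTop, P N {ω | δ < |X N ω - c|} < ENNReal.ofReal (ε / (3 * (2 * M + 1))) :=
    (tendsto_order.1 (h δ hδ0)).2 _ (ENNReal.ofReal_pos.2 hη)
  obtain ⟨N₀, hN₀⟩ := (hev.and hP).exists_forall_of_atTop
  refine ⟨N₀, fun N hN => ?_⟩
  obtain ⟨hbad, hPN⟩ := hN₀ N hN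
  haveI := hPN
  have hA : MeasurableSet {ω | δ < |X N ω - c|} := measurableSet_lt measurable_const ((hXm N).sub_const c).abs
  -- pointwise: `|X − c| ≤ δ + 2M · 𝟙_{bad}`
  have hpt : ∀ ω, |X N ω - c| ≤ δ + (2 * M) * ({ω | δ < |X N ω - c|} : Set (Ω N)).indicator 1 ω := by
    intro ω
    by_cases hω : ω ∈ {ω | δ < |X N ω - c|}
    · rw [indicator_of_mem hω, Pi.one_apply, mul_one]
      have : |X N ω - c| ≤ |X N ω| + |c| := abs_sub _ _
      linarith [hM N ω]
    · rw [indicator_of_notMem hω, mul_zero, add_zero]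
      simpa using hω
  have hXi : Integrable (fun ω => X N ω) (P N) :=
    (integrable_const M).mono' (hXm N).aestronglyMeasurable (Eventually.of_forall fun ω => by
      rw [Real.norm_eq_abs]; exact hM N ω)
  have hind : Integrable (fun ω => ({ω | δ < |X N ω - c|} : Set (Ω N)).indicator (1 : Ω N → ℝ) ω) (P N) :=
    (integrable_const (1 : ℝ)).indicator hA
  rw [Real.dist_eq]
  calc |∫ ω, X N ω ∂P N - c| = |∫ ω, (X N ω - c) ∂P N| := by
        rw [integral_sub hXi (integrable_const c), integral_const, smul_eq_mul, probReal_univ, one_mul]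
    _ ≤ ∫ ω, |X N ω - c| ∂P N := abs_integral_le_integral_abs
    _ ≤ ∫ ω, (δ + (2 * M) * ({ω | δ < |X N ω - c|} : Set (Ω N)).indicator 1 ω) ∂P N := by
        refine integral_mono (hXi.sub (integrable_const c)).abs ((integrable_const δ).add (hind.const_mul _))
          fun ω => hpt ω
    _ = δ + 2 * M * (P N).real {ω | δ < |X N ω - c|} := by
        rw [integral_add (integrable_const δ) (hind.const_mul _), integral_const, smul_eq_mul, probReal_univ,
          one_mul, integral_const_mul, integral_indicator_one hA]
    _ < δ + 2 * M * (ε / (3 * (2 * M + 1))) + ε / 3 := by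
        have h1 : (P N).real {ω | δ < |X N ω - c|} ≤ ε / (3 * (2 * M + 1)) := by
          rw [Measure.real, ← ENNReal.toReal_ofReal hη.le]
          exact ENNReal.toReal_mono ENNReal.ofReal_ne_top hbad.le
        nlinarith [mul_le_mul_of_nonneg_left h1 (by positivity : (0 : ℝ) ≤ 2 * M)]
    _ ≤ ε := by
        rw [hδ]
        have h2 : 2 * M * (ε / (3 * (2 * M + 1))) ≤ ε / 3 := by
          rw [div_mul_eq_div_div, mul_div_assoc']
          rw [div_le_div_iff₀ (by positivity) (by positivity)]
          nlinarith
        linarith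

/-! ## Test functions determine a density -/

/-- **Continuous test functions determine a nonnegative integrable density on `𝕋³`**: if `f, g ≥ 0` are
integrable and `∫ χ f = ∫ χ g` for every continuous `χ`, then `f = g` almost everywhere (the finite measures
`f dx` and `g dx` have the same integrals of bounded continuous functions). [folklore] -/
theorem ae_eq_of_forall_integral_mul_eq {f g : T3 → ℝ} (hf : Integrable f) (hg : Integrable g)
    (hf0 : ∀ x, 0 ≤ f x) (hg0 : ∀ x, 0 ≤ g x)
    (h : ∀ χ : T3 → ℝ, Continuous χ → ∫ x, χ x * f x = ∫ x, χ x * g x) : f =ᵐ[volume] g := by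
  set μf : Measure T3 := volume.withDensity fun x => ENNReal.ofReal (f x) with hμf
  set μg : Measure T3 := volume.withDensity fun x => ENNReal.ofReal (g x) with hμg
  haveI : IsFiniteMeasure μf := isFiniteMeasure_withDensity_ofReal hf.2
  haveI : IsFiniteMeasure μg := isFiniteMeasure_withDensity_ofReal hg.2
  have hfm : AEMeasurable (fun x => ENNReal.ofReal (f x)) volume := hf.1.aemeasurable.ennreal_ofReal
  have hgm : AEMeasurable (fun x => ENNReal.ofReal (g x)) volume := hg.1.aemeasurable.ennreal_ofReal
  have heq : μf = μg := by
    refine ext_of_forall_integral_eq_of_IsFiniteMeasure fun χ => ?_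
    rw [hμf, hμg, integral_withDensity_eq_integral_toReal_smul₀ hfm (ae_of_all _ fun _ => ENNReal.ofReal_lt_top),
      integral_withDensity_eq_integral_toReal_smul₀ hgm (ae_of_all _ fun _ => ENNReal.ofReal_lt_top)]
    simp only [ENNReal.toReal_ofReal (hf0 _), ENNReal.toReal_ofReal (hg0 _), smul_eq_mul]
    have h' := h χ χ.continuous
    simp_rw [mul_comm (χ _)] at h'
    exact h'
  have hae : (fun x => ENNReal.ofReal (f x)) =ᵐ[volume] fun x => ENNReal.ofReal (g x) :=
    (withDensity_eq_iff_of_sigmaFinite hfm hgm).1 heq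
  filter_upwards [hae] with x hx
  exact (ENNReal.ofReal_eq_ofReal_iff (hf0 x) (hg0 x)).1 hx
/-! ## Small analytic preliminaries for the assembly -/

/-- A composition `g ∘ f` with `g` continuous on a set containing the values of the measurable `f` is measurable.
[folklore] -/
theorem measurable_comp_of_continuousOn {α : Type*} [MeasurableSpace α] {f : α → ℝ} {g : ℝ → ℝ} {s : Set ℝ}
    (hg : ContinuousOn g s) (hf : Measurable f) (hfs : ∀ x, f x ∈ s) :
    Measurable fun x => g (f x) := by
  have h1 : Continuous (s.restrict g) := hg.restrict
  have h2 : Measurable fun x => (⟨f x, hfs x⟩ : s) := hf.subtype_mk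
  have : (fun x => g (f x)) = (s.restrict g) ∘ fun x => (⟨f x, hfs x⟩ : s) := by funext x; rfl
  rw [this]
  exact h1.measurable.comp h2

/-- Cube-root bookkeeping: `0 ≤ σ < r^{1/3}` with `r ≥ 0` gives `σ³ < r`. [folklore] -/
theorem pow_three_lt_of_lt_rpow_third {σ r : ℝ} (hσ : 0 ≤ σ) (hr : 0 ≤ r) (h : σ < r ^ ((1 : ℝ) / 3)) : σ ^ 3 < r := by
  have h1 : σ ^ 3 < (r ^ ((1 : ℝ) / 3)) ^ 3 := pow_lt_pow_left₀ h hσ (by norm_num)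
  have h2 : (r ^ ((1 : ℝ) / 3)) ^ 3 = r := by
    rw [← Real.rpow_natCast, ← Real.rpow_mul hr]; norm_num
  rwa [h2] at h1

/-- A jointly smooth positive field is bounded below by a positive constant on `[0, t] × 𝕋³`, `t < T`. [folklore] -/
theorem exists_pos_le_of_isSmoothSpaceTimeOn {T t : ℝ} {f : ℝ → T3 → ℝ} (hf : Torus.IsSmoothSpaceTimeOn (Ico 0 T) f)
    (hpos : ∀ s ∈ Ico 0 T, ∀ x, 0 < f s x) (ht : t ∈ Ico 0 T) :
    ∃ c : ℝ, 0 < c ∧ ∀ s ∈ Icc 0 t, ∀ x, c ≤ f s x := by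
  have hinv : Torus.IsSmoothSpaceTimeOn (Ico 0 T) fun s y => (f s y)⁻¹ :=
    isSmoothSpaceTimeOn_comp_density hf (contDiffOn_inv ℝ) fun s hs x => (hpos s hs x).ne'
  obtain ⟨C, hC⟩ := hinv.exists_norm_le_of_isCompact isCompact_Icc (Icc_subset_Ico_right ht.2)
  have hC0 : 0 < C := by
    have h := hC 0 ⟨le_rfl, ht.1⟩ 0
    rw [Real.norm_eq_abs, abs_of_pos (inv_pos.2 (hpos 0 ⟨le_rfl, ht.1.trans_lt ht.2⟩ 0))] at h
    exact (inv_pos.2 (hpos 0 ⟨le_rfl, ht.1.trans_lt ht.2⟩ 0)).trans_le h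
  refine ⟨C⁻¹, inv_pos.2 hC0, fun s hs x => ?_⟩
  have hsT : s ∈ Ico 0 T := ⟨hs.1, hs.2.trans_lt ht.2⟩
  have h := hC s hs x
  rw [Real.norm_eq_abs, abs_of_pos (inv_pos.2 (hpos s hsT x))] at h
  rw [inv_le_comm₀ hC0 (hpos s hsT x)]
  exact h

/-- **Entropy conservation along dilute classical hard-sphere Euler solutions** (specialisation of
`PolynomialCompressionEntropy.integral_density_mul_comp_ent_eq` to the typed hard-sphere law under the
`HsEosLowDensity` data, with `Φ = id`): `∫ ρ s_σ(ρ, θ) (t) = ∫ ρ s_σ(ρ, θ) (0)` for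
`s_σ(r, ϑ) = 3/2 log ϑ − log r − f_ex(rσ³)`, whenever the packing stays `< η₀`. [folklore] -/
theorem integral_density_mul_hsEnt_eq {η₀ : ℝ} {F : ℝ → ℝ} (hη₀ : 0 < η₀) (hF : AnalyticOnNhd ℝ F (Ioo (-η₀) η₀))
    (hEq : EqOn hsExcessFreeEnergy F (Ico 0 η₀)) {σ T : ℝ} {ρ θ : ℝ → T3 → ℝ} {u : ℝ → T3 → V3} (hσ : 0 < σ)
    (hE : IsHardSphereEulerSolution σ T ρ u θ) (hpack : ∀ t ∈ Ico 0 T, ∀ x, ρ t x * σ ^ 3 < η₀) {t : ℝ}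
    (ht : t ∈ Ico 0 T) :
    ∫ x, ρ t x * (3 / 2 * Real.log (θ t x) - Real.log (ρ t x) - hsExcessFreeEnergy (ρ t x * σ ^ 3)) =
      ∫ x, ρ 0 x * (3 / 2 * Real.log (θ 0 x) - Real.log (ρ 0 x) - hsExcessFreeEnergy (ρ 0 x * σ ^ 3)) := by
  obtain ⟨hJ, hζ, hG, hG', hp⟩ := PolynomialCompressionEntropy.hs_eos_data hη₀ hF hEq hσ
  have hρJ : ∀ t ∈ Ico 0 T, ∀ x, ρ t x ∈ Ioo 0 (η₀ / σ ^ 3) := fun t ht x =>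
    ⟨hE.density_pos t ht x, (lt_div_iff₀ (pow_pos hσ 3)).2 (hpack t ht x)⟩
  have h := PolynomialCompressionEntropy.integral_density_mul_comp_ent_eq hE hJ hζ hρJ (fun t _ x => hp _ _) hG hG'
    (Φ := id) contDiff_id ht
  have h0 : (0 : ℝ) ∈ Ico 0 T := ⟨le_rfl, ht.1.trans_lt ht.2⟩
  have hrew : ∀ s ∈ Ico 0 T, ∀ x, PolynomialCompressionEntropy.ent (fun r => F (r * σ ^ 3)) ρ θ s x =
      3 / 2 * Real.log (θ s x) - Real.log (ρ s x) - hsExcessFreeEnergy (ρ s x * σ ^ 3) := by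
    intro s hs x
    unfold PolynomialCompressionEntropy.ent
    rw [hEq ⟨(mul_pos (hE.density_pos s hs x) (pow_pos hσ 3)).le, hpack s hs x⟩]
  simp only [id] at h
  calc _ = ∫ x, ρ t x * PolynomialCompressionEntropy.ent (fun r => F (r * σ ^ 3)) ρ θ t x := by
        refine integral_congr_ae (Eventually.of_forall fun x => ?_); simp only [hrew t ht x]
    _ = ∫ x, ρ 0 x * PolynomialCompressionEntropy.ent (fun r => F (r * σ ^ 3)) ρ θ 0 x := h
    _ = _ := by
        refine integral_congr_ae (Eventually.of_forall fun x => ?_); simp only [hrew 0 h0 x]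

/-- The empirical density field tested against a bounded `χ` is bounded: `|ρ̂_z(χ)| ≤ C`. [folklore] -/
theorem abs_empiricalDensityField_le {N : ℕ} (z : Config (N + 1) (Fin 3) T3) {χ : T3 → ℝ} {C : ℝ}
    (hC : ∀ x, |χ x| ≤ C) : |empiricalDensityField z χ| ≤ C := by
  rw [empiricalDensityField_eq_sum, abs_mul, abs_of_nonneg (by positivity)]
  push_cast
  calc ((N : ℝ) + 1)⁻¹ * |∑ i, χ (z i).1| ≤ ((N : ℝ) + 1)⁻¹ * ∑ i : Fin (N + 1), C :=
        mul_le_mul_of_nonneg_left ((Finset.abs_sum_le_sum_abs _ _).trans (Finset.sum_le_sum fun i _ => hC _))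
          (by positivity)
    _ = C := by rw [Finset.sum_const, Finset.card_univ, Fintype.card_fin, nsmul_eq_mul]; push_cast; field_simp


end Summit.AtomisticToContinuum.HydrodynamicLimit.Theorems.JaynesSqueezeSqueeze

end
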